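import Mathlib.FieldTheory.Galois.Basic
import Mathlib.NumberTheory.Cyclotomic.CyclotomicCharacter
import Mathlib.RingTheory.PrincipalIdealDomain
import Mathlib.LinearAlgebra.Finsupp.LinearCombination
import HarnessLib

/-!
# Radicals in abelian extensions (Schinzel-type descent)

Let `E/k` be a finite Galois extension with **abelian** Galois group and let `x ∈ E` with
`xᴺ = a ∈ kˣ`. If every root of unity of `k` is killed by `w`, then `x ^ w ∈ kˣ · μ(E)`:
some power of `x` bounded independently of `N` and `x` already lies in `k` up to a root of unity
(the half of Schinzel's theorem on abelian binomials that is needed for Kummer theory over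
`k(μ_∞)`: a radical of `k` lying in `k(μ_∞)` is, up to roots of unity, a `w`-th root of an element
of `k`). Proof: `ε_σ = σ(x)/x` is a `1`-cocycle of `G = Gal(E/k)` with values in the cyclic group
`C = μ_N(E)`, on which `G` acts through a character `χ` (`σ(t) = t^{χ(σ)}`); commutativity of `G`
gives `ε_τ^{χ(σ)-1} = ε_σ^{χ(τ)-1}`, so for the positive generator `d` of the ideal
`(#C, χ(τ) - 1 : τ ∈ G) ⊆ ℤ`, writing `d = n₀ #C + ∑ n_τ (χ(τ) - 1)` and `η = ∏ ε_τ^{n_τ}` one gets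
`ε_σ^d = σ(η)/η` (Sah's lemma made explicit), whence `x^d / η ∈ k`; and `d ∣ w` because `C`
contains an element of order `d` fixed by `G`, i.e. a root of unity of `k`.

* `Literature.FieldTheory.Kummer.AbelianRadicalDescent.pow_eq_algebraMap_mul_rootOfUnity`.

## References

* A. Schinzel, *Abelian binomials, power residues and exponential congruences*, Acta Arith. 32
  (1977), Thm 2 (abelian binomials).
* M. Bays, B. Zilber, *Covers of multiplicative groups of algebraically closed fields of arbitrary
  characteristic*, Bull. LMS 43 (2011), Prop. 2.5 (second case: finitely generated extensions of
  `ℚ(μ)`).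
-/

noncomputable section

namespace Literature.FieldTheory.Kummer

namespace AbelianRadicalDescent

variable {K E : Type*} [Field K] [Field E] [Algebra K E]

/-- In a commutative group, `Aᵖ B = B^q A` gives `A^{p-1} = B^{q-1}`. [folklore] -/
theorem zpow_sub_one_eq_of_comm {G : Type*} [CommGroup G] {A B : G} {p q : ℤ}
    (h : A ^ p * B = B ^ q * A) : A ^ (p - 1) = B ^ (q - 1) := by
  rw [zpow_sub_one, zpow_sub_one]
  have : A ^ p * B * (A⁻¹ * B⁻¹) = B ^ q * A * (A⁻¹ * B⁻¹) := by rw [h]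
  calc A ^ p * A⁻¹ = A ^ p * B * (A⁻¹ * B⁻¹) := by
        rw [mul_comm A⁻¹ B⁻¹, ← mul_assoc, mul_assoc (A ^ p), mul_inv_cancel, mul_one]
    _ = B ^ q * A * (A⁻¹ * B⁻¹) := this
    _ = B ^ q * B⁻¹ := by rw [← mul_assoc, mul_assoc (B ^ q), mul_inv_cancel, mul_one]

/-- `∏ᵢ a ^ f i = a ^ ∑ᵢ f i` for integer exponents. [folklore] -/
theorem prod_zpow_eq_zpow_sum {G ι : Type*} [CommGroup G] (a : G) (s : Finset ι) (f : ι → ℤ) :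
    ∏ i ∈ s, a ^ f i = a ^ ∑ i ∈ s, f i := by
  classical
  induction s using Finset.induction_on with
  | empty => simp
  | insert i s hi ih => rw [Finset.prod_insert hi, Finset.sum_insert hi, ih, zpow_add]

/-- **Descent of radicals in abelian extensions.** Let `E/k` be finite Galois with abelian Galois
group, `w` an exponent of the roots of unity of `k`, and `x ∈ E` with `xᴺ = a ∈ kˣ`
(`N ≥ 1`). Then `x ^ w = g · θ` with `g ∈ k` and `θ` an `N`-th root of unity of `E`.
[cite: Schinzel1977AbelianBinomials, Thm 2] -/
theorem pow_eq_algebraMap_mul_rootOfUnity [FiniteDimensional K E] [IsGalois K E]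
    (hcomm : ∀ σ τ : E ≃ₐ[K] E, σ * τ = τ * σ)
    {w : ℕ} (hwK : ∀ θ : K, ∀ m : ℕ, 0 < m → θ ^ m = 1 → θ ^ w = 1)
    {x : E} {N : ℕ} (hN : 0 < N) {a : K} (ha : a ≠ 0) (hx : x ^ N = algebraMap K E a) :
    ∃ (g : K) (θ : E), θ ^ N = 1 ∧ x ^ w = algebraMap K E g * θ := by
  classical
  haveI : NeZero N := ⟨hN.ne'⟩
  have hx0 : x ≠ 0 := by
    intro h
    rw [h, zero_pow hN.ne'] at hx
    exact ha ((map_eq_zero_iff _ (algebraMap K E).injective).1 hx.symm)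
  have hσx0 : ∀ σ : E ≃ₐ[K] E, σ x ≠ 0 := fun σ h =>
    hx0 (by simpa using congrArg σ.symm h)
  -- the cocycle `ε σ = σ(x)/x`, an `N`-th root of unity
  let xu : Eˣ := Units.mk0 x hx0
  let ε : (E ≃ₐ[K] E) → Eˣ := fun σ => Units.mk0 (σ x) (hσx0 σ) * xu⁻¹
  have hεval : ∀ σ, ((ε σ : Eˣ) : E) = σ x * x⁻¹ := fun σ => rfl
  have hεx : ∀ σ, ((ε σ : Eˣ) : E) * x = σ x := fun σ => by
    rw [hεval, inv_mul_cancel_right₀ hx0]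
  have hεN : ∀ σ, ε σ ∈ rootsOfUnity N E := fun σ => by
    rw [mem_rootsOfUnity']
    rw [hεval, mul_pow, ← map_pow, hx, AlgEquiv.commutes, inv_pow, hx, mul_inv_cancel₀]
    exact (map_ne_zero_iff _ (algebraMap K E).injective).2 ha
  -- cocycle identity `ε(στ) = σ(ε τ) ε σ`
  have hcocycle : ∀ σ τ, ((ε (σ * τ) : Eˣ) : E) = σ ((ε τ : Eˣ) : E) * ((ε σ : Eˣ) : E) := by
    intro σ τ
    have h1 : ((ε (σ * τ) : Eˣ) : E) * x = σ ((ε τ : Eˣ) : E) * ((ε σ : Eˣ) : E) * x := by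
      rw [hεx, AlgEquiv.mul_apply, ← hεx τ, map_mul, mul_assoc, hεx σ]
    exact mul_right_cancel₀ hx0 h1
  -- the cyclic group `C = μ_N(E)` and the character `χ`
  let C : Subgroup Eˣ := rootsOfUnity N E
  haveI : Finite C := inferInstanceAs (Finite (rootsOfUnity N E))
  set N₁ : ℕ := Nat.card C with hN₁
  have hN₁pos : 0 < N₁ := Nat.card_pos
  have hχ : ∀ σ : E ≃ₐ[K] E, ∃ m : ℤ, ∀ t ∈ C, σ ((t : Eˣ) : E) = ((t ^ m : Eˣ) : E) := fun σ =>
    rootsOfUnity.integer_power_of_ringEquiv' N σ.toRingEquiv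
  choose χ hχ using hχ
  -- commutativity: `(ε τ)^(χ σ - 1) = (ε σ)^(χ τ - 1)`
  have hstar : ∀ σ τ, (ε τ) ^ (χ σ - 1) = (ε σ) ^ (χ τ - 1) := by
    intro σ τ
    apply zpow_sub_one_eq_of_comm
    apply Units.ext
    have h1 := hcocycle σ τ
    have h2 := hcocycle τ σ
    rw [hcomm σ τ] at h1
    rw [h1, hχ σ (ε τ) (hεN τ), hχ τ (ε σ) (hεN σ)] at h2
    simpa using h2
  -- every `ε σ` is killed by `N₁ = #C`
  have hεN₁ : ∀ σ, (ε σ) ^ N₁ = 1 := fun σ => by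
    have : ((⟨ε σ, hεN σ⟩ : C) ^ N₁) = 1 := by rw [hN₁]; exact pow_card_eq_one'
    exact congrArg Subtype.val this
  -- the ideal `(N₁, χ τ - 1)` and its positive generator `d`
  let fam : Option (E ≃ₐ[K] E) → ℤ := fun o => o.elim (N₁ : ℤ) fun τ => χ τ - 1
  set I : Ideal ℤ := Ideal.span (Set.range fam) with hI
  let g₀ : ℤ := Submodule.IsPrincipal.generator I
  have hIg : I = Ideal.span {g₀} := (Submodule.IsPrincipal.span_singleton_generator I).symm
  set d : ℕ := g₀.natAbs with hd
  have hN₁I : (N₁ : ℤ) ∈ I := Ideal.subset_span ⟨none, rfl⟩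
  have hχI : ∀ τ, χ τ - 1 ∈ I := fun τ => Ideal.subset_span ⟨some τ, rfl⟩
  have hdI : (d : ℤ) ∈ I := by
    rcases Int.natAbs_eq g₀ with h | h
    · rw [hd, ← h]; exact Submodule.IsPrincipal.generator_mem I
    · rw [hd, show (g₀.natAbs : ℤ) = -g₀ by omega]
      exact I.neg_mem (Submodule.IsPrincipal.generator_mem I)
  have hd_dvd : ∀ z ∈ I, (d : ℤ) ∣ z := fun z hz => by
    rw [hIg, Ideal.mem_span_singleton] at hz
    exact Int.natAbs_dvd.2 hz
  have hdN₁ : d ∣ N₁ := by exact_mod_cast hd_dvd _ hN₁I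
  have hd0 : d ≠ 0 := fun h => by
    rw [h] at hdN₁
    exact hN₁pos.ne' (Nat.eq_zero_of_zero_dvd hdN₁)
  have hdpos : 0 < d := Nat.pos_of_ne_zero hd0
  -- Bezout: `d = ∑ n o • fam o`
  obtain ⟨n, hn⟩ := (Submodule.mem_span_range_iff_exists_fun ℤ).1 hdI
  -- `η = ∏ (ε τ)^(n τ)` trivialises `ε^d`
  let η : Eˣ := ∏ τ, (ε τ) ^ n (some τ)
  have hηC : η ∈ C := Subgroup.prod_mem _ fun τ _ => Subgroup.zpow_mem _ (hεN τ) _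
  have hηpow : ∀ σ, η ^ (χ σ - 1) = (ε σ) ^ (d : ℤ) := by
    intro σ
    have h1 : η ^ (χ σ - 1) = ∏ τ, (ε σ) ^ ((χ τ - 1) * n (some τ)) := by
      rw [← Finset.prod_zpow]
      refine Finset.prod_congr rfl fun τ _ => ?_
      rw [← zpow_mul, mul_comm, zpow_mul, hstar σ τ, ← zpow_mul]
    rw [h1, prod_zpow_eq_zpow_sum]
    -- `∑ (χ τ - 1) n τ = d - n none * N₁`
    have hsum : ∑ τ, (χ τ - 1) * n (some τ) = d - n none * N₁ := by
      have h2 : (d : ℤ) = n none * N₁ + ∑ τ, (χ τ - 1) * n (some τ) := by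
        rw [← hn, Fintype.sum_option]
        simp only [fam, Option.elim, smul_eq_mul]
        congr 1
        exact Finset.sum_congr rfl fun τ _ => by ring
      rw [h2]; ring
    rw [hsum, zpow_sub, mul_comm (n none), zpow_mul, zpow_natCast, zpow_natCast, hεN₁ σ, one_zpow,
      inv_one, mul_one]
  have hση : ∀ σ : E ≃ₐ[K] E, σ (η : E) = ((ε σ : Eˣ) : E) ^ d * η := by
    intro σ
    rw [hχ σ η hηC]
    have : η ^ χ σ = (ε σ) ^ (d : ℤ) * η := by
      rw [← hηpow σ, zpow_sub_one, inv_mul_cancel_right]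
    rw [this, Units.val_mul, Units.val_zpow_eq_zpow_val, zpow_natCast]
  -- `x^d / η` is fixed by `G`, hence in `k`
  have hη0 : (η : E) ≠ 0 := η.ne_zero
  have hfix : ∀ σ : E ≃ₐ[K] E, σ (x ^ d * (η : E)⁻¹) = x ^ d * (η : E)⁻¹ := by
    intro σ
    rw [map_mul, map_inv₀, map_pow, ← hεx σ, mul_pow, hση σ, mul_inv, ← mul_assoc]
    congr 1
    rw [mul_assoc, mul_comm (x ^ d), ← mul_assoc, mul_inv_cancel₀ (pow_ne_zero _ (ε σ).ne_zero),
      one_mul]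
  obtain ⟨g₁, hg₁⟩ := (IsGalois.mem_range_algebraMap_iff_fixed (x ^ d * (η : E)⁻¹)).2 hfix
  have hxd : x ^ d = algebraMap K E g₁ * η := by
    rw [hg₁, inv_mul_cancel_right₀ hη0]
  -- `d ∣ w`: `C` has an element of order `d` fixed by `G`, a root of unity of `k`
  have hdw : d ∣ w := by
    obtain ⟨γ, hγ⟩ := IsCyclic.exists_generator (α := C)
    have hγord : orderOf γ = N₁ := orderOf_eq_card_of_forall_mem_zpowers hγ
    let η₁ : C := γ ^ (N₁ / d)
    have hη₁d : η₁ ^ d = 1 := by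
      change (γ ^ (N₁ / d)) ^ d = 1
      rw [← pow_mul, Nat.div_mul_cancel hdN₁, ← hγord, pow_orderOf_eq_one]
    -- `η₁` is fixed by every `σ`
    have hη₁fix : ∀ σ : E ≃ₐ[K] E, σ (((η₁ : C) : Eˣ) : E) = (((η₁ : C) : Eˣ) : E) := by
      intro σ
      rw [hχ σ _ η₁.2]
      obtain ⟨k, hk⟩ := hd_dvd _ (hχI σ)
      have : χ σ = 1 + d * k := by omega
      rw [this, zpow_add, zpow_one, zpow_mul, zpow_natCast]
      have h2 : ((η₁ : C) : Eˣ) ^ d = 1 := by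
        have := congrArg Subtype.val hη₁d
        simpa using this
      rw [h2, one_zpow, mul_one]
    obtain ⟨θ₁, hθ₁⟩ := (IsGalois.mem_range_algebraMap_iff_fixed _).2 hη₁fix
    have hθ₁d : θ₁ ^ d = 1 := by
      apply (algebraMap K E).injective
      rw [map_pow, hθ₁, map_one]
      have := congrArg (fun u : C => ((u : Eˣ) : E)) hη₁d
      simpa using this
    have hθ₁w : θ₁ ^ w = 1 := hwK θ₁ d hdpos hθ₁d
    have hη₁w : η₁ ^ w = 1 := by
      apply Subtype.ext
      apply Units.ext
      have := congrArg (algebraMap K E) hθ₁w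
      rw [map_pow, hθ₁, map_one] at this
      simpa using this
    -- so `N₁ ∣ (N₁ / d) * w`, i.e. `d ∣ w`
    have h1 : N₁ ∣ N₁ / d * w := by
      have h0 : orderOf γ ∣ N₁ / d * w := by
        apply orderOf_dvd_of_pow_eq_one
        rw [pow_mul]
        exact hη₁w
      rwa [hγord] at h0
    have h2 : d * (N₁ / d) ∣ w * (N₁ / d) := by
      rw [Nat.mul_div_cancel' hdN₁, mul_comm]
      exact h1
    exact Nat.dvd_of_mul_dvd_mul_right (Nat.div_pos (Nat.le_of_dvd hN₁pos hdN₁) hdpos) h2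
  -- conclusion
  obtain ⟨q, hq⟩ := hdw
  refine ⟨g₁ ^ q, (η : E) ^ q, ?_, ?_⟩
  · rw [← pow_mul, mul_comm, pow_mul]
    have : (η : E) ^ N = 1 := by
      have := (mem_rootsOfUnity' N η).1 hηC
      exact this
    rw [this, one_pow]
  · rw [hq, pow_mul, hxd, mul_pow, map_pow]

end AbelianRadicalDescent

end Literature.FieldTheory.Kummer
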